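import Summits.BirchSwinnertonDyer.BirchSwinnertonDyer.Theorems.CMKolyvaginAtInertTwoLagrangianTransversalLayeredLemmas
import HarnessLib

/-!
# Route `CMKolyvaginAtInertTwo`, crux `CMKolyvaginExactAtInertTwo` (stmt-BirchSwinnertonDyer-24277):
# THE TRANSVERSAL LAGRANGIAN OF A FILTERED SYMPLECTIC MODULE — the layered criterion
# (T5′, doubly-filtered case, KERNEL-STATUS §13.3 (TL-filtered))

Seat `bsd-line-cmk2-p1` g14 (cell `bsd-print-cf2`); helper (`--supports stmt-BirchSwinnertonDyer-24277`).
THEOREMS ONLY: no definition, no named fact, no `sorry`; no item is closed; BSD is not proved by this.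
Pure finite-abelian-group algebra; sequel of `…LagrangianTransversal` (p682724: the elementary case) and
`…LagrangianTransversalLayeredLemmas` (the counting lemmas of the induction step).

For a finite abelian `p`-group `T` (`p^k · T = 0`) with a nondegenerate alternating `B : T × T → ℚ/ℤ`
(a symplectic module; a Lagrangian = an isotropic `L` with `(#L)² = #T`), a subgroup `Y ≤ T[p]` is NOT
always avoidable by a Lagrangian when `(#Y)² ≤ #T` (`T = (ℤ/2)² ⊕ (ℤ/4)²`, `Y = (2T)[2]`). Write
`R_j = p^j T` and `F_j = R_j ∩ T[p]` (the `j`-th layer of the `p`-torsion; `#F_j = p^{2 m_j}`,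
`m_j` = number of hyperbolic planes of exponent `> p^j`). This file proves the LAYERED CRITERION:

* `exists_lagrangian_inf_eq_bot_of_layered` — if `(#(Y ∩ R_j))² ≤ #F_j` for EVERY `j ≥ 0`, then some
  Lagrangian `L` has `L ∩ Y = 0`.

(The condition is also necessary layer by layer — every Lagrangian meets `F_j` in dimension `≥ m_j` —
but that half is not needed and not proved here.) Proof: induction on `#T` through a hyperbolic plane
of MAXIMAL order `n = p^a = exp T` (Wall's Lemma 1, `isCompl_hyperbolicPlane`): choose `f` of order
`n` with (i) `p^{a-1} f ∉ Y` and (ii) `B(·, f) ≢ 0` on the deepest non-zero layer `Y ∩ R_{j₁}` of `Y`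
— both are "avoid a proper subgroup" and a group is not the union of two proper subgroups; take a
partner `e` (`B(f, e) = 1/n`), `H = ⟨f, e⟩`, `T = H ⊕ H^⊥`; the trace `Y' = (Y + ⟨f⟩) ∩ H^⊥` of `Y` in
`H^⊥` satisfies the layered condition there because (ii) cuts every non-zero layer of `Y` by a factor
`p` (`#(Y' ∩ R'_j) · p ≤ #(Y ∩ R_j)`) while `#F_j ≤ p² · #F'_j`; then `L = L' ⊕ ⟨f⟩` with `L'` from
the induction hypothesis, and `L ∩ Y ⊆ ⟨p^{a-1} f⟩ ∩ Y = 0` by (i).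

This is the transversality input for (IND) in the doubly-filtered case (both `Ш(E/ℚ)[2^∞]` and
`Ш(E^{(d_K)}/ℚ)[2^∞]` of exponent `≥ 4`), KERNEL-STATUS §13.3; the elementary case p682724 is `k = 1`.

References: [Wall1963QuadraticFormsFiniteGroups] Lemma 1, Lemma 7; [TignolAmitsur1986SymplecticModules]
Thm. 4.1; [McCallumLMS1991] §5 (p. 307).
-/

-- single-conjunct summit: `Summit.BirchSwinnertonDyer.BirchSwinnertonDyer.…` repeats the name by design
set_option linter.dupNamespace false
set_option autoImplicit false

noncomputable section

open AddSubgroup Literature.GroupTheory.FiniteAbelian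

namespace Summit.BirchSwinnertonDyer.BirchSwinnertonDyer.Theorems.KolyvaginLiftGroupsTwo

universe u v

section Layered

variable {T : Type u} [AddCommGroup T] (B : T →+ T →+ AddCircle (1 : ℚ))

/-- For an alternating pairing, `B(x, y) = 0 ↔ B(y, x) = 0`. [folklore] -/
private theorem apply_eq_zero_comm' {Q : Type v} [AddCommGroup Q]
    (B : T →+ T →+ Q) (halt : ∀ x, B x x = 0) (x y : T) : B x y = 0 ↔ B y x = 0 := by
  have h := halt (x + y)
  simp only [map_add, AddMonoidHom.add_apply, halt x, halt y, zero_add, add_zero] at h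
  rw [eq_neg_of_add_eq_zero_right h, neg_eq_zero]

/-- The class of `1/n` in `ℚ/ℤ` is non-zero for `n ≥ 2`. [folklore] -/
private theorem coe_one_div_ne_zero' {n : ℕ} (hn : 1 < n) :
    ((((1 : ℚ) / n : ℚ)) : AddCircle (1 : ℚ)) ≠ 0 := by
  rw [← AddMonoid.addOrderOf_eq_one_iff.ne, AddCircle.addOrderOf_period_div (by omega)]
  omega

/-! ### The layered transversal Lagrangian -/

/-- **The transversal Lagrangian of a filtered symplectic module (layered criterion).** `T` a finite
abelian group with `p^k · T = 0` (`p` prime), `B : T × T → ℚ/ℤ` alternating and nondegenerate,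
`Y ≤ T[p]` with `(#(Y ∩ p^jT))² ≤ #(p^jT ∩ T[p])` for every `j ≥ 0`. Then there is an isotropic
`L ≤ T` with `(#L)² = #T` and `L ∩ Y = 0`. [folklore] -/
theorem exists_lagrangian_inf_eq_bot_of_layered [Finite T] (halt : ∀ x, B x x = 0)
    (hnd : ∀ x, (∀ y, B x y = 0) → x = 0) {p : ℕ} (hp : p.Prime) {k : ℕ}
    (hpT : ∀ t : T, p ^ k • t = 0) (Y : AddSubgroup T) (hYp : ∀ y ∈ Y, p • y = 0)
    (hY : ∀ j : ℕ, Nat.card ↥(Y ⊓ (nsmulAddMonoidHom (p ^ j) : T →+ T).range) ^ 2 ≤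
      Nat.card ↥((nsmulAddMonoidHom (p ^ j) : T →+ T).range ⊓ (nsmulAddMonoidHom p : T →+ T).ker)) :
    ∃ L : AddSubgroup T, (∀ a ∈ L, ∀ b ∈ L, B a b = 0) ∧ Nat.card L ^ 2 = Nat.card T ∧
      L ⊓ Y = ⊥ := by
  suffices key : ∀ (m : ℕ) (T : Type u) [AddCommGroup T] [Finite T]
      (B : T →+ T →+ AddCircle (1 : ℚ)), (∀ x, B x x = 0) → (∀ x, (∀ y, B x y = 0) → x = 0) →
      (∀ t : T, p ^ k • t = 0) → ∀ Y : AddSubgroup T, (∀ y ∈ Y, p • y = 0) →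
      (∀ j : ℕ, Nat.card ↥(Y ⊓ (nsmulAddMonoidHom (p ^ j) : T →+ T).range) ^ 2 ≤
        Nat.card ↥((nsmulAddMonoidHom (p ^ j) : T →+ T).range ⊓ (nsmulAddMonoidHom p : T →+ T).ker)) →
      Nat.card T = m →
      ∃ L : AddSubgroup T, (∀ a ∈ L, ∀ b ∈ L, B a b = 0) ∧ Nat.card L ^ 2 = Nat.card T ∧
        L ⊓ Y = ⊥ from key _ T B halt hnd hpT Y hYp hY rfl
  intro m
  induction m using Nat.strong_induction_on with
  | _ m ih =>
  intro T _ _ B halt hnd hpT Y hYp hY hm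
  classical
  haveI : Fact p.Prime := ⟨hp⟩
  have hp1 : 1 < p := hp.one_lt
  -- notation
  set R : ℕ → AddSubgroup T := fun j ↦ (nsmulAddMonoidHom (p ^ j) : T →+ T).range with hR_def
  set Tp : AddSubgroup T := (nsmulAddMonoidHom p : T →+ T).ker with hTp_def
  have hmemR : ∀ j t, t ∈ R j ↔ ∃ s : T, (p ^ j) • s = t := fun j t ↦ by
    rw [hR_def]; simp only [AddMonoidHom.mem_range, nsmulAddMonoidHom_apply]
  have hmemTp : ∀ t, t ∈ Tp ↔ p • t = 0 := fun t ↦ by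
    rw [hTp_def, AddMonoidHom.mem_ker, nsmulAddMonoidHom_apply]
  have hRmono : ∀ {j j' : ℕ}, j ≤ j' → R j' ≤ R j := fun h ↦ range_nsmul_pow_le h
  -- `T = 0`
  by_cases htriv : Subsingleton T
  · refine ⟨⊥, by simp, ?_, by rw [bot_inf_eq]⟩
    rw [AddSubgroup.card_bot, Nat.card_of_subsingleton (0 : T)]; ring
  rw [not_subsingleton_iff_nontrivial] at htriv
  -- `Y = 0`: any Lagrangian
  by_cases hY0 : Y = ⊥
  · obtain ⟨L, hL, -, hLcard⟩ := exists_lagrangian_sq_eq_card B halt hnd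
    exact ⟨L, hL, hLcard, by rw [hY0, inf_bot_eq]⟩
  -- the exponent `n = p^a`, `a = a' + 1`
  obtain ⟨a, -, ha⟩ : ∃ a ≤ k, AddMonoid.exponent T = p ^ a :=
    (Nat.dvd_prime_pow hp).mp (AddMonoid.exponent_dvd_of_forall_nsmul_eq_zero hpT)
  have ha0 : a ≠ 0 := by
    intro h
    rw [h, pow_zero] at ha
    exact (not_subsingleton_iff_nontrivial.mpr htriv) (AddMonoid.exp_eq_one_iff.mp ha)
  obtain ⟨a', rfl⟩ : ∃ a', a = a' + 1 := Nat.exists_eq_succ_of_ne_zero ha0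
  have hexp : ∀ t : T, p ^ (a' + 1) • t = 0 := fun t ↦ by
    rw [← ha]; exact AddMonoid.exponent_nsmul_eq_zero t
  have hRa : R (a' + 1) = ⊥ := by
    rw [eq_bot_iff]
    intro t ht
    obtain ⟨s, rfl⟩ := (hmemR _ t).mp ht
    rw [hexp, AddSubgroup.mem_bot]
  -- the deepest non-zero layer `j₁` of `Y`
  have hex : ∃ j, Y ⊓ R j = ⊥ := ⟨a' + 1, by rw [hRa, inf_bot_eq]⟩
  set j₀ := Nat.find hex with hj₀_def
  have hj₀ : Y ⊓ R j₀ = ⊥ := Nat.find_spec hex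
  have hj₀le : j₀ ≤ a' + 1 := Nat.find_le (by rw [hRa, inf_bot_eq])
  have hj₀0 : j₀ ≠ 0 := by
    intro h
    rw [h] at hj₀
    apply hY0
    rw [eq_bot_iff, ← hj₀]
    refine le_inf le_rfl fun t _ ↦ (hmemR 0 t).mpr ⟨t, by rw [pow_zero, one_smul]⟩
  obtain ⟨j₁, hj₁⟩ : ∃ j₁, j₀ = j₁ + 1 := Nat.exists_eq_succ_of_ne_zero hj₀0
  have hYj₁ : Y ⊓ R j₁ ≠ ⊥ := by
    have := Nat.find_min hex (m := j₁) (by rw [← hj₀_def, hj₁]; exact Nat.lt_succ_self j₁)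
    exact this
  have hj₁a : j₁ ≤ a' := by omega
  have hYvan : ∀ j, j₁ < j → Y ⊓ R j = ⊥ := fun j hj ↦ by
    rw [eq_bot_iff, ← hj₀]
    exact inf_le_inf_left Y (hRmono (by omega))
  -- the two proper subgroups to avoid
  set U : AddSubgroup T := Y.comap (nsmulAddMonoidHom (p ^ a') : T →+ T) with hU_def
  have hmemU : ∀ t, t ∈ U ↔ (p ^ a') • t ∈ Y := fun t ↦ by
    rw [hU_def, AddSubgroup.mem_comap, nsmulAddMonoidHom_apply]
  have hU : U ≠ ⊤ := by
    intro hUtop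
    have hle : R a' ≤ Y := by
      intro t ht
      obtain ⟨s, rfl⟩ := (hmemR _ t).mp ht
      exact (hmemU s).mp (by rw [hUtop]; exact AddSubgroup.mem_top s)
    have hRTp : R a' ≤ Tp := by
      intro t ht
      obtain ⟨s, rfl⟩ := (hmemR _ t).mp ht
      rw [hmemTp, smul_smul, ← pow_succ', hexp]
    have h1 := hY a'
    rw [inf_eq_right.mpr hle, inf_eq_left.mpr hRTp, sq] at h1
    have hcard1 : Nat.card ↥(R a') ≤ 1 := by
      by_contra h
      push Not at h
      have := Nat.mul_lt_mul_of_lt_of_le h (le_refl (Nat.card ↥(R a'))) (Nat.card_pos (α := ↥(R a')))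
      rw [one_mul] at this
      exact absurd h1 (not_le.mpr this)
    have hRbot : R a' = ⊥ := AddSubgroup.eq_bot_of_card_le (R a') hcard1
    have : AddMonoid.exponent T ∣ p ^ a' := by
      apply AddMonoid.exponent_dvd_of_forall_nsmul_eq_zero
      intro t
      have ht : (p ^ a') • t ∈ R a' := (hmemR _ _).mpr ⟨t, rfl⟩
      rwa [hRbot, AddSubgroup.mem_bot] at ht
    rw [ha, Nat.pow_dvd_pow_iff_le_right hp1] at this
    omega
  let V : AddSubgroup T :=
    { carrier := {t : T | ∀ y ∈ Y ⊓ R j₁, B y t = 0}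
      zero_mem' := fun y _ ↦ by rw [map_zero]
      add_mem' := by
        intro s t hs ht y hy
        rw [map_add, hs y hy, ht y hy, add_zero]
      neg_mem' := by
        intro s hs y hy
        rw [map_neg, hs y hy, neg_zero] }
  have hmemV : ∀ t, t ∈ V ↔ ∀ y ∈ Y ⊓ R j₁, B y t = 0 := fun t ↦ Iff.rfl
  have hV : V ≠ ⊤ := by
    intro hVtop
    obtain ⟨⟨y₀, hy₀⟩, hy₀0⟩ := (AddSubgroup.ne_bot_iff_exists_ne_zero).mp hYj₁
    have : y₀ = 0 := hnd y₀ fun t ↦ (hmemV t).mp (by rw [hVtop]; exact AddSubgroup.mem_top t) y₀ hy₀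
    exact hy₀0 (Subtype.ext this)
  -- `f` of maximal order with `p^{a'} f ∉ Y` and `B(·, f) ≢ 0` on `Y ∩ R j₁`
  obtain ⟨f, hfU, hfV⟩ := exists_not_mem_not_mem hU hV
  rw [hmemU] at hfU
  have hfbar0 : (p ^ a') • f ≠ 0 := fun h ↦ hfU (by rw [h]; exact Y.zero_mem)
  have hordf : addOrderOf f = p ^ (a' + 1) := addOrderOf_eq_prime_pow hfbar0 (hexp f)
  have hordfbar : addOrderOf ((p ^ a') • f) = p := addOrderOf_nsmul_pow_eq hp hordf
  have hBf : ∃ y ∈ Y ⊓ R j₁, B y f ≠ 0 := by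
    by_contra h
    push Not at h
    exact hfV ((hmemV f).mpr h)
  set n : ℕ := p ^ (a' + 1) with hn_def
  have hn : 0 < n := pow_pos hp.pos _
  have hn1 : 1 < n := Nat.one_lt_pow (by omega) hp1
  set u : AddCircle (1 : ℚ) := ((((1 : ℚ) / n : ℚ)) : AddCircle (1 : ℚ)) with hu_def
  have hu0 : u ≠ 0 := coe_one_div_ne_zero' hn1
  -- partner `e`
  obtain ⟨e, hfe⟩ := exists_apply_eq_coe_one_div B hnd f
  rw [hordf, ← hu_def] at hfe
  have hpf : n • f = 0 := hexp f
  have hpe : n • e = 0 := hexp e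
  -- the plane `H = ⟨f, e⟩` and its orthogonal `Hp`
  obtain ⟨hdisj, hHc⟩ := isCompl_hyperbolicPlane B halt hn hpf hpe hfe
  set H : AddSubgroup T := zmultiples f ⊔ zmultiples e with hH_def
  set Hp : AddSubgroup T := (B.flip f).ker ⊓ (B.flip e).ker with hHp_def
  have hmemHp : ∀ t, t ∈ Hp ↔ B t f = 0 ∧ B t e = 0 := fun t ↦ by
    rw [hHp_def, AddSubgroup.mem_inf, AddMonoidHom.mem_ker, AddMonoidHom.mem_ker,
      AddMonoidHom.flip_apply, AddMonoidHom.flip_apply]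
  have hfH : f ∈ H := AddSubgroup.mem_sup_left (AddSubgroup.mem_zmultiples f)
  have hHpf : ∀ t ∈ Hp, B t f = 0 := fun t ht ↦ ((hmemHp t).mp ht).1
  -- the restricted pairing
  set Bp : Hp →+ Hp →+ AddCircle (1 : ℚ) := (B.comp Hp.subtype).compl₂ Hp.subtype with hBp_def
  have hBp : ∀ x y : Hp, Bp x y = B x y := fun x y ↦ rfl
  have haltp : ∀ x : Hp, Bp x x = 0 := fun x ↦ by rw [hBp, halt]
  have hndp : ∀ x : Hp, (∀ y : Hp, Bp x y = 0) → x = 0 :=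
    nondegenerate_restrict_hyperbolicPlane B halt hnd hn hpf hpe hfe
  have hpTp : ∀ t : Hp, p ^ k • t = 0 := fun t ↦ Subtype.ext (by
    rw [AddSubgroup.coe_nsmul, hpT, AddSubgroup.coe_zero])
  -- orders and cardinalities
  have horde : addOrderOf e = n := by
    refine le_antisymm ?_ (Nat.le_of_dvd (addOrderOf_pos e) ?_)
    · exact Nat.le_of_dvd hn (addOrderOf_dvd_of_nsmul_eq_zero hpe)
    · rw [← AddCircle.addOrderOf_period_div (p := (1 : ℚ)) hn, addOrderOf_dvd_iff_nsmul_eq_zero,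
        ← hu_def, ← hfe, ← map_nsmul, addOrderOf_nsmul_eq_zero, map_zero]
  have hcardH : Nat.card H = n * n := by
    rw [hH_def, card_sup_eq_mul_of_disjoint hdisj, Nat.card_zmultiples, Nat.card_zmultiples, hordf,
      horde]
  have hcardT : Nat.card T = n * n * Nat.card Hp := by
    rw [← hcardH, ← card_sup_eq_mul_of_disjoint hHc.disjoint, hHc.sup_eq_top, AddSubgroup.card_top]
  have hcardHp : Nat.card Hp < m := by
    rw [← hm, hcardT]
    have h1 : 1 < n * n := Nat.one_lt_mul_iff.mpr ⟨hn, hn, Or.inl hn1⟩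
    have := Nat.card_pos (α := Hp)
    nlinarith
  have hcardHTp : Nat.card ↥(H ⊓ Tp) ≤ p * p :=
    card_plane_inf_ker_le hp hordf (horde.trans hn_def) hdisj
  -- the trace `Y'` of `Y` in `Hp` and its layered condition
  set Y' : AddSubgroup Hp := (Y ⊔ zmultiples f).comap Hp.subtype with hY'_def
  have hmemY' : ∀ z : Hp, z ∈ Y' ↔ (z : T) ∈ Y ⊔ zmultiples f := fun z ↦ by
    rw [hY'_def, AddSubgroup.mem_comap]; rfl
  have hY'p : ∀ z ∈ Y', p • z = 0 := trace_nsmul_eq_zero B halt hp hordf hHc hfH hHpf hYp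
  have hY' : ∀ j : ℕ, Nat.card ↥(Y' ⊓ (nsmulAddMonoidHom (p ^ j) : Hp →+ Hp).range) ^ 2 ≤
      Nat.card ↥((nsmulAddMonoidHom (p ^ j) : Hp →+ Hp).range ⊓ (nsmulAddMonoidHom p : Hp →+ Hp).ker) := by
    intro j
    set R' : AddSubgroup Hp := (nsmulAddMonoidHom (p ^ j) : Hp →+ Hp).range with hR'_def
    set Tp' : AddSubgroup Hp := (nsmulAddMonoidHom p : Hp →+ Hp).ker with hTp'_def
    have hone : 1 ≤ Nat.card ↥(R' ⊓ Tp') := Nat.card_pos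
    by_cases hj : a' < j
    · -- above the top layer everything vanishes
      have hR'bot : R' = ⊥ := by
        rw [eq_bot_iff]
        rintro t ⟨s, rfl⟩
        rw [AddSubgroup.mem_bot]
        obtain ⟨c, hc⟩ := Nat.pow_dvd_pow p hj
        refine Subtype.ext ?_
        rw [nsmulAddMonoidHom_apply, AddSubgroup.coe_nsmul, hc, mul_comm, mul_smul, ← hn_def, hexp,
          smul_zero, AddSubgroup.coe_zero]
      rw [hR'bot, inf_bot_eq, AddSubgroup.card_bot, one_pow]
      exact Nat.card_pos
    push Not at hj
    -- Step C: `#F_j ≤ p² · #F'_j`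
    have hC : Nat.card ↥(R j ⊓ Tp) ≤ Nat.card ↥(R' ⊓ Tp') * (p * p) :=
      (card_range_inf_ker_le_of_isCompl hHc p j).trans (Nat.mul_le_mul_left _ hcardHTp)
    -- Step A: `#(Y' ∩ R'_j) ≤ #(Y₀ ∩ R_j)`, `Y₀ = Y ∩ f^⊥`
    have hA : Nat.card ↥(Y' ⊓ R') ≤ Nat.card ↥((Y ⊓ (B.flip f).ker) ⊓ R j) :=
      card_trace_inf_range_le B halt hp hj hordf hHc hfH hHpf hYp
    -- Step B: `#(Y₀ ∩ R_j) · p ≤ #(Y ∩ R_j)` for `j ≤ j₁`; `Y ∩ R_j = 0` for `j > j₁`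
    by_cases hjj : j₁ < j
    · have hYRbot : Y ⊓ R j = ⊥ := hYvan j hjj
      have hY₀bot : (Y ⊓ (B.flip f).ker) ⊓ R j = ⊥ := by
        rw [eq_bot_iff, ← hYRbot]; exact inf_le_inf_right _ inf_le_left
      rw [hY₀bot, AddSubgroup.card_bot] at hA
      have : Nat.card ↥(Y' ⊓ R') = 1 := le_antisymm hA Nat.card_pos
      rw [this, one_pow]
      exact hone
    push Not at hjj
    have hB : Nat.card ↥((Y ⊓ R j) ⊓ (B.flip f).ker) * p ≤ Nat.card ↥(Y ⊓ R j) := by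
      refine card_inf_ker_mul_le B hp (Y ⊓ R j) (fun z hz ↦ hYp z (AddSubgroup.mem_inf.mp hz).1) f ?_
      obtain ⟨y, hy, hyf⟩ := hBf
      exact ⟨y, (inf_le_inf_left Y (hRmono hjj)) hy, hyf⟩
    rw [inf_right_comm] at hB
    -- assemble
    have hfinal : Nat.card ↥(Y' ⊓ R') ^ 2 * (p * p) ≤ Nat.card ↥(R' ⊓ Tp') * (p * p) := by
      calc Nat.card ↥(Y' ⊓ R') ^ 2 * (p * p)
          ≤ Nat.card ↥((Y ⊓ (B.flip f).ker) ⊓ R j) ^ 2 * (p * p) :=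
            Nat.mul_le_mul_right _ (Nat.pow_le_pow_left hA 2)
        _ = (Nat.card ↥((Y ⊓ (B.flip f).ker) ⊓ R j) * p) ^ 2 := by ring
        _ ≤ Nat.card ↥(Y ⊓ R j) ^ 2 := Nat.pow_le_pow_left hB 2
        _ ≤ Nat.card ↥(R j ⊓ Tp) := hY j
        _ ≤ Nat.card ↥(R' ⊓ Tp') * (p * p) := hC
    exact Nat.le_of_mul_le_mul_right hfinal (Nat.mul_pos hp.pos hp.pos)
  -- induction in `Hp`
  obtain ⟨L₀, hiso₀, hcard₀, hinf₀⟩ := ih _ hcardHp Hp Bp haltp hndp hpTp Y' hY'p hY' rfl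
  set L₁ : AddSubgroup T := L₀.map Hp.subtype with hL₁_def
  have hL₁le : L₁ ≤ Hp := AddSubgroup.map_subtype_le L₀
  have hisoL₁ : ∀ x ∈ L₁, ∀ y ∈ L₁, B x y = 0 := by
    intro x hx y hy
    obtain ⟨x₀, hx₀, rfl⟩ := AddSubgroup.mem_map.mp hx
    obtain ⟨y₀, hy₀, rfl⟩ := AddSubgroup.mem_map.mp hy
    exact hiso₀ x₀ hx₀ y₀ hy₀
  have hcardL₁ : Nat.card L₁ = Nat.card L₀ :=
    (Nat.card_congr (AddSubgroup.equivMapOfInjective L₀ Hp.subtype Hp.subtype_injective).toEquiv).symm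
  have hdisjL : Disjoint L₁ (zmultiples f) :=
    hHc.symm.disjoint.mono hL₁le (le_sup_left (b := zmultiples e))
  refine ⟨L₁ ⊔ zmultiples f, ?_, ?_, ?_⟩
  · -- isotropic
    intro x hx y hy
    obtain ⟨a₁, ha₁, a₂, ha₂, rfl⟩ := AddSubgroup.mem_sup.mp hx
    obtain ⟨b₁, hb₁, b₂, hb₂, rfl⟩ := AddSubgroup.mem_sup.mp hy
    obtain ⟨c, rfl⟩ := AddSubgroup.mem_zmultiples_iff.mp ha₂
    obtain ⟨d, rfl⟩ := AddSubgroup.mem_zmultiples_iff.mp hb₂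
    have h1 : B a₁ (d • f) = 0 := by rw [map_zsmul, hHpf a₁ (hL₁le ha₁), smul_zero]
    have h2 : B (c • f) b₁ = 0 := by
      rw [apply_eq_zero_comm' B halt, map_zsmul, hHpf b₁ (hL₁le hb₁), smul_zero]
    have h3 : B (c • f) (d • f) = 0 := by
      rw [map_zsmul, map_zsmul, AddMonoidHom.zsmul_apply, halt f, smul_zero, smul_zero]
    simp only [map_add, AddMonoidHom.add_apply, hisoL₁ a₁ ha₁ b₁ hb₁, h1, h2, h3, add_zero]
  · -- order
    rw [card_sup_eq_mul_of_disjoint hdisjL, hcardL₁, Nat.card_zmultiples, hordf, hcardT, mul_pow, hcard₀]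
    ring
  · -- transversal to `Y`
    rw [eq_bot_iff]
    intro y hy
    obtain ⟨hyL, hyY⟩ := AddSubgroup.mem_inf.mp hy
    obtain ⟨l, hl, w, hw, rfl⟩ := AddSubgroup.mem_sup.mp hyL
    obtain ⟨l₀, hl₀, rfl⟩ := AddSubgroup.mem_map.mp hl
    have hlX : (Hp.subtype l₀ : T) ∈ Y ⊔ zmultiples f := by
      have : (Hp.subtype l₀ : T) = (Hp.subtype l₀ + w) - w := by rw [add_sub_cancel_right]
      rw [this]
      exact AddSubgroup.sub_mem _ (AddSubgroup.mem_sup_left hyY) (AddSubgroup.mem_sup_right hw)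
    have hl₀0 : l₀ = 0 := by
      have : l₀ ∈ L₀ ⊓ Y' := AddSubgroup.mem_inf.mpr ⟨hl₀, (hmemY' l₀).mpr hlX⟩
      rwa [hinf₀, AddSubgroup.mem_bot] at this
    rw [hl₀0, map_zero, zero_add] at hyY ⊢
    rw [AddSubgroup.mem_bot]
    by_contra hw0
    have hpw : p • w = 0 := hYp w hyY
    have hw' : w ∈ zmultiples ((p ^ a') • f) := mem_zmultiples_nsmul_of_nsmul_eq_zero hp hordf hw hpw
    have hordw : addOrderOf w = p := addOrderOf_eq_prime hpw hw0
    have heq : zmultiples w = zmultiples ((p ^ a') • f) := by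
      refine AddSubgroup.eq_of_le_of_card_ge (AddSubgroup.zmultiples_le_of_mem hw') ?_
      rw [Nat.card_zmultiples, Nat.card_zmultiples, hordfbar, hordw]
    have : (p ^ a') • f ∈ zmultiples w := by rw [heq]; exact AddSubgroup.mem_zmultiples _
    exact hfU ((AddSubgroup.zmultiples_le_of_mem hyY) this)

end Layered

end Summit.BirchSwinnertonDyer.BirchSwinnertonDyer.Theorems.KolyvaginLiftGroupsTwo

end
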